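import Summits.AtomisticToContinuum.BoseEinsteinCondensation.Theorems.BECHeatBathGapJastrowDobrushinRungOscillation

/-!
# Route `BECHeatBathGap` — support item `JastrowDobrushinRung` (stmt-AtomisticToContinuum-14373):
# Cauchy–Schwarz, the log-convexity transfer and the total-variation comparison lemma (helper file 4)

Helpers for the proof of
`Summit.AtomisticToContinuum.BoseEinsteinCondensation.Theses.BECHeatBathGap.JastrowDobrushinRung`
(approximate tensorisation of variance with constant 2 for the Jastrow law under
`5N∫(1-f²) ≤ L³`, via Dobrushin uniqueness ⇒ heat-bath spectral gap ≥ 1 - r, Wu 2006, re-proved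
from scratch). As in helper file 1, the operators `S` (one-site average), `T` (heat bath),
`P = N⁻¹∑T_j` (random-scan Gibbs sampler) and the weights `w = B_j π_j` are variables with
defining hypotheses `hS, hT, hP, hw, …` (no auxiliary definitions).

This file (pure analysis): Cauchy–Schwarz for `⟨F,G⟩ = ∫ F G v` (`integral_mul_mul_sq_le`), the
transfer lemma `le_mul_of_sq_chain` (`a_{2^m}² ≤ a₀ a_{2^{m+1}}` and `a_n ≤ K ρⁿ` force
`a₁ ≤ ρ a₀` — how geometric decay in the oscillation norm yields the sharp `L²` one-step bound
without the spectral theorem), the midpoint lemma and the comparison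
`|∫φ p/∫p - ∫φ p'/∫p'| ≤ δ η / ζ` of two normalised densities (`abs_div_sub_div_le`).
-/

noncomputable section

namespace Summit.AtomisticToContinuum.BoseEinsteinCondensation.Theorems

namespace JastrowDobrushin

open MeasureTheory Function
open scoped ENNReal

variable {ι : Type*} [DecidableEq ι] {E : Type*} [MeasurableSpace E]
  {u : Measure E} {S : ι → ((ι → E) → ℝ) → (ι → E) → ℝ}

/-- **Cauchy–Schwarz** for the semi-inner product `⟨F, G⟩ = ∫ F G v` (`v ≥ 0`), bounded
measurable functions on a finite measure space. [folklore] -/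
theorem integral_mul_mul_sq_le {α : Type*} [MeasurableSpace α] {μ : Measure α} [IsFiniteMeasure μ]
    {F G v : α → ℝ} (hFm : Measurable F) (hGm : Measurable G) {C C' : ℝ}
    (hFb : ∀ X, |F X| ≤ C) (hGb : ∀ X, |G X| ≤ C') (hvm : Measurable v)
    (hv1 : ∀ X, 0 ≤ v X ∧ v X ≤ 1) :
    (∫ X, F X * G X * v X ∂μ) ^ 2 ≤
      (∫ X, F X * F X * v X ∂μ) * (∫ X, G X * G X * v X ∂μ) := by
  set A := ∫ X, F X * F X * v X ∂μ with hA
  set Bv := ∫ X, F X * G X * v X ∂μ with hBv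
  set Cv := ∫ X, G X * G X * v X ∂μ with hCv
  have iA : Integrable (fun X => F X * F X * v X) μ :=
    integrable_mul_w (hFm.mul hFm) (C := C * C) (fun X => by
      rw [abs_mul]; exact mul_le_mul (hFb X) (hFb X) (abs_nonneg _)
        ((abs_nonneg _).trans (hFb X))) hvm hv1
  have iB : Integrable (fun X => F X * G X * v X) μ :=
    integrable_mul_w (hFm.mul hGm) (C := C * C') (fun X => by
      rw [abs_mul]; exact mul_le_mul (hFb X) (hGb X) (abs_nonneg _)
        ((abs_nonneg _).trans (hFb X))) hvm hv1
  have iC : Integrable (fun X => G X * G X * v X) μ :=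
    integrable_mul_w (hGm.mul hGm) (C := C' * C') (fun X => by
      rw [abs_mul]; exact mul_le_mul (hGb X) (hGb X) (abs_nonneg _)
        ((abs_nonneg _).trans (hGb X))) hvm hv1
  have hquad : ∀ t : ℝ, 0 ≤ Cv * (t * t) + (-2 * Bv) * t + A := by
    intro t
    have h0 : 0 ≤ ∫ X, (F X - t * G X) ^ 2 * v X ∂μ :=
      integral_nonneg fun X => mul_nonneg (sq_nonneg _) (hv1 X).1
    have hpt : (fun X => (F X - t * G X) ^ 2 * v X) = fun X =>
        (F X * F X * v X - (2 * t) * (F X * G X * v X)) + (t * t) * (G X * G X * v X) := by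
      funext X; ring
    have i1 : Integrable (fun X => F X * F X * v X - (2 * t) * (F X * G X * v X)) μ :=
      iA.sub (iB.const_mul _)
    rw [hpt, integral_add i1 (iC.const_mul _), integral_sub iA (iB.const_mul _),
      integral_const_mul, integral_const_mul] at h0
    linarith
  have hd := discrim_le_zero hquad
  rw [discrim] at hd
  nlinarith

omit [DecidableEq ι] [MeasurableSpace E] in
/-- **The log-convexity transfer.** If `0 ≤ a₀, a₁`, `a_{2^m}² ≤ a₀ a_{2^{m+1}}` (Cauchy–Schwarz
for a symmetric operator) and `a_n ≤ K ρ^n` (`n ≥ 1`), then `a₁ ≤ ρ a₀`: geometric decay in ANY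
norm forces the sharp one-step `L²` bound. [folklore] -/
theorem le_mul_of_sq_chain (a : ℕ → ℝ) {K ρ : ℝ} (hρ : 0 ≤ ρ) (h0 : 0 ≤ a 0) (h1 : 0 ≤ a 1)
    (hCS : ∀ m : ℕ, a (2 ^ m) ^ 2 ≤ a 0 * a (2 ^ (m + 1)))
    (hK : ∀ n : ℕ, 1 ≤ n → a n ≤ K * ρ ^ n) : a 1 ≤ ρ * a 0 := by
  -- the chain `a₁^(2^m) ≤ a₀^(2^m - 1) a_{2^m}`
  have chain : ∀ m : ℕ, a 1 ^ (2 ^ m) ≤ a 0 ^ (2 ^ m - 1) * a (2 ^ m) := by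
    intro m
    induction m with
    | zero => simp
    | succ m ih =>
      have h2 : (2 : ℕ) ^ (m + 1) = 2 ^ m + 2 ^ m := by ring
      have hpos : 1 ≤ 2 ^ m := Nat.one_le_two_pow
      calc a 1 ^ (2 ^ (m + 1)) = (a 1 ^ (2 ^ m)) ^ 2 := by rw [← pow_mul, pow_succ]
        _ ≤ (a 0 ^ (2 ^ m - 1) * a (2 ^ m)) ^ 2 :=
            pow_le_pow_left₀ (pow_nonneg h1 _) ih 2
        _ = a 0 ^ (2 ^ m - 1) * a 0 ^ (2 ^ m - 1) * a (2 ^ m) ^ 2 := by ring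
        _ ≤ a 0 ^ (2 ^ m - 1) * a 0 ^ (2 ^ m - 1) * (a 0 * a (2 ^ (m + 1))) :=
            mul_le_mul_of_nonneg_left (hCS m) (mul_nonneg (pow_nonneg h0 _) (pow_nonneg h0 _))
        _ = a 0 ^ (2 ^ m - 1 + (2 ^ m - 1) + 1) * a (2 ^ (m + 1)) := by
            rw [pow_add, pow_add, pow_one]; ring
        _ = a 0 ^ (2 ^ (m + 1) - 1) * a (2 ^ (m + 1)) := by
            congr 2; omega
  rcases h0.lt_or_eq with h0' | h0'
  · -- `a₀ > 0`
    by_contra hlt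
    rw [not_le] at hlt
    have ha1 : 0 < a 1 := (mul_nonneg hρ h0).trans_lt hlt
    rcases hρ.lt_or_eq with hρ' | hρ'
    · -- `ρ > 0`: `x = a₁/(ρ a₀) > 1` and `x^(2^m) ≤ K / a₀` for all `m`
      have hx : 1 < a 1 / (ρ * a 0) := by rw [one_lt_div (mul_pos hρ' h0')]; exact hlt
      have hbd : ∀ m : ℕ, (a 1 / (ρ * a 0)) ^ (2 ^ m) ≤ K / a 0 := by
        intro m
        have hc := (chain m).trans (mul_le_mul_of_nonneg_left (hK _ Nat.one_le_two_pow)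
          (pow_nonneg h0 _))
        rw [div_pow, mul_pow, div_le_div_iff₀ (by positivity) h0']
        calc a 1 ^ 2 ^ m * a 0 ≤ a 0 ^ (2 ^ m - 1) * (K * ρ ^ 2 ^ m) * a 0 :=
              mul_le_mul_of_nonneg_right hc h0
          _ = K * (ρ ^ 2 ^ m * (a 0 ^ (2 ^ m - 1) * a 0 ^ 1)) := by ring
          _ = K * (ρ ^ 2 ^ m * a 0 ^ 2 ^ m) := by
              rw [← pow_add]; congr 3; exact Nat.sub_add_cancel Nat.one_le_two_pow
      obtain ⟨n, hn⟩ := pow_unbounded_of_one_lt (K / a 0) hx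
      have h3 : (a 1 / (ρ * a 0)) ^ n ≤ (a 1 / (ρ * a 0)) ^ (2 ^ n) :=
        pow_le_pow_right₀ hx.le Nat.lt_two_pow_self.le
      exact absurd ((hn.trans_le h3).trans_le (hbd n)) (lt_irrefl _)
    · -- `ρ = 0`: `a₁ ≤ K ρ = 0`
      have := hK 1 le_rfl
      rw [← hρ', pow_one, mul_zero] at this
      exact absurd this (not_le.mpr ha1)
  · -- `a₀ = 0`: Cauchy–Schwarz gives `a₁ = 0`
    have h := hCS 0
    rw [← h0', zero_mul, pow_zero] at h
    have : a 1 = 0 := by nlinarith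
    rw [this, ← h0', mul_zero]



/-! ### From an `L¹` bound on one-site densities to the Dobrushin hypothesis -/

omit [MeasurableSpace E] in
/-- A function of oscillation `≤ δ` is within `δ/2` of the midpoint of its range. [folklore] -/
theorem exists_abs_sub_le_half [Nonempty E] {φ : E → ℝ} {Cφ δ : ℝ} (hφb : ∀ z, |φ z| ≤ Cφ)
    (hφδ : ∀ z z', |φ z - φ z'| ≤ δ) : ∃ m : ℝ, ∀ z, |φ z - m| ≤ δ / 2 := by
  have hbb : BddBelow (Set.range φ) :=
    ⟨-Cφ, by rintro _ ⟨z, rfl⟩; exact (abs_le.mp (hφb z)).1⟩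
  have hba : BddAbove (Set.range φ) :=
    ⟨Cφ, by rintro _ ⟨z, rfl⟩; exact (abs_le.mp (hφb z)).2⟩
  have hne : (Set.range φ).Nonempty := Set.range_nonempty φ
  refine ⟨(sInf (Set.range φ) + sSup (Set.range φ)) / 2, fun z => ?_⟩
  have h1 : sInf (Set.range φ) ≤ φ z := csInf_le hbb ⟨z, rfl⟩
  have h2 : φ z ≤ sSup (Set.range φ) := le_csSup hba ⟨z, rfl⟩
  have h3 : sSup (Set.range φ) ≤ sInf (Set.range φ) + δ := by
    refine csSup_le hne ?_
    rintro _ ⟨z', rfl⟩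
    have : φ z' - δ ≤ sInf (Set.range φ) := by
      refine le_csInf hne ?_
      rintro _ ⟨z'', rfl⟩
      have := hφδ z' z''
      rw [abs_le] at this
      linarith
    linarith
  rw [abs_le]
  constructor <;> linarith

/-- **Total-variation comparison of two normalised densities.** If `0 ≤ p, p' ≤ 1` have masses
`∫ p, ∫ p' ≥ ζ > 0` and `∫ |p - p'| ≤ η` (w.r.t. a probability measure `u`), then the normalised
laws `p/∫p` and `p'/∫p'` differ by at most `η/ζ · δ` on every test function of oscillation `δ`
(`|∫ φ d(P - P')| ≤ osc(φ) · ‖P - P'‖_TV` and `‖P - P'‖_TV ≤ η/ζ`). [folklore] -/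
theorem abs_div_sub_div_le [IsProbabilityMeasure u] {p p' : E → ℝ} (hpm : Measurable p)
    (hp'm : Measurable p') (hp : ∀ z, 0 ≤ p z ∧ p z ≤ 1) (hp' : ∀ z, 0 ≤ p' z ∧ p' z ≤ 1)
    {ζ η : ℝ} (hζ : 0 < ζ) (hζZ : ζ ≤ ∫ z, p z ∂u) (hζZ' : ζ ≤ ∫ z, p' z ∂u)
    (hη : ∫ z, |p z - p' z| ∂u ≤ η) {φ : E → ℝ} (hφm : Measurable φ) {Cφ δ : ℝ}
    (hφb : ∀ z, |φ z| ≤ Cφ) (hφδ : ∀ z z', |φ z - φ z'| ≤ δ) :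
    |(∫ z, φ z * p z ∂u) / (∫ z, p z ∂u) - (∫ z, φ z * p' z ∂u) / (∫ z, p' z ∂u)| ≤
      δ * η / ζ := by
  have hE : Nonempty E := by
    by_contra h
    rw [not_nonempty_iff] at h
    have := IsProbabilityMeasure.measure_univ (μ := u)
    rw [Set.univ_eq_empty_iff.mpr h, measure_empty] at this
    exact zero_ne_one this
  obtain ⟨m, hm⟩ := exists_abs_sub_le_half hφb hφδ
  have hδ : 0 ≤ δ := (abs_nonneg _).trans (hφδ hE.some hE.some)
  set Z := ∫ z, p z ∂u with hZdef
  set Z' := ∫ z, p' z ∂u with hZ'def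
  have hZpos : 0 < Z := hζ.trans_le hζZ
  have hZ'pos : 0 < Z' := hζ.trans_le hζZ'
  -- integrability
  have hp1 : ∀ z, |p z| ≤ 1 := fun z => by rw [abs_of_nonneg (hp z).1]; exact (hp z).2
  have hp'1 : ∀ z, |p' z| ≤ 1 := fun z => by rw [abs_of_nonneg (hp' z).1]; exact (hp' z).2
  have ip : Integrable p u := integrable_of_bounded hpm hp1
  have ip' : Integrable p' u := integrable_of_bounded hp'm hp'1
  have iφp : Integrable (fun z => φ z * p z) u :=
    integrable_mul_w hφm hφb hpm hp
  have iφp' : Integrable (fun z => φ z * p' z) u :=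
    integrable_mul_w hφm hφb hp'm hp'
  -- the signed kernel `q = p/Z - p'/Z'` has `u`-integral zero
  set q : E → ℝ := fun z => p z / Z - p' z / Z' with hq
  have hqm : Measurable q := (hpm.div_const _).sub (hp'm.div_const _)
  have iq : Integrable q u := (ip.div_const _).sub (ip'.div_const _)
  have hq0 : ∫ z, q z ∂u = 0 := by
    simp only [hq]
    rw [integral_sub (ip.div_const _) (ip'.div_const _), integral_div, integral_div,
      div_self hZpos.ne', div_self hZ'pos.ne', sub_self]
  have hqb : ∀ z, |q z| ≤ 1 / Z + 1 / Z' := fun z => by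
    simp only [hq]
    refine (abs_sub _ _).trans (add_le_add ?_ ?_)
    · rw [abs_div, abs_of_pos hZpos]; exact div_le_div_of_nonneg_right (hp1 z) hZpos.le
    · rw [abs_div, abs_of_pos hZ'pos]; exact div_le_div_of_nonneg_right (hp'1 z) hZ'pos.le
  -- rewrite the difference as `∫ (φ - m) q`
  have hdiff : (∫ z, φ z * p z ∂u) / Z - (∫ z, φ z * p' z ∂u) / Z' =
      ∫ z, (φ z - m) * q z ∂u := by
    have h1 : (fun z => (φ z - m) * q z) = fun z =>
        (φ z * p z / Z - φ z * p' z / Z') - m * q z := by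
      funext z; simp only [hq]; ring
    have j1 : Integrable (fun z => φ z * p z / Z) u := iφp.div_const _
    have j2 : Integrable (fun z => φ z * p' z / Z') u := iφp'.div_const _
    have j12 : Integrable (fun z => φ z * p z / Z - φ z * p' z / Z') u := j1.sub j2
    have j3 : Integrable (fun z => m * q z) u := iq.const_mul _
    rw [h1, integral_sub j12 j3, integral_sub j1 j2, integral_div, integral_div,
      integral_const_mul, hq0, mul_zero, sub_zero]
  -- `∫ |q| ≤ 2 η / ζ`
  have hL1 : ∫ z, |q z| ∂u ≤ 2 * η / ζ := by
    have hpt : ∀ z, |q z| ≤ |p z - p' z| / Z + p' z * |1 / Z - 1 / Z'| := fun z => by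
      have : q z = (p z - p' z) / Z + p' z * (1 / Z - 1 / Z') := by simp only [hq]; ring
      rw [this]
      refine (abs_add_le _ _).trans (add_le_add ?_ ?_)
      · rw [abs_div, abs_of_pos hZpos]
      · rw [abs_mul, abs_of_nonneg (hp' z).1]
    have i1 : Integrable (fun z => |p z - p' z| / Z) u := ((ip.sub ip').abs).div_const _
    have i2 : Integrable (fun z => p' z * |1 / Z - 1 / Z'|) u := ip'.mul_const _
    have hZZ' : |Z' - Z| ≤ η := by
      rw [hZdef, hZ'def, ← integral_sub ip' ip]
      refine (abs_integral_le_integral_abs).trans (le_trans (le_of_eq ?_) hη)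
      exact integral_congr_ae (ae_of_all _ fun z => abs_sub_comm _ _)
    have hηpos : 0 ≤ η := (integral_nonneg fun z => abs_nonneg _).trans hη
    have i12 : Integrable (fun z => |p z - p' z| / Z + p' z * |1 / Z - 1 / Z'|) u := i1.add i2
    calc ∫ z, |q z| ∂u ≤ ∫ z, (|p z - p' z| / Z + p' z * |1 / Z - 1 / Z'|) ∂u :=
          integral_mono (iq.abs) i12 hpt
      _ = (∫ z, |p z - p' z| ∂u) / Z + Z' * |1 / Z - 1 / Z'| := by
          rw [integral_add i1 i2, integral_div, integral_mul_const]
      _ = (∫ z, |p z - p' z| ∂u) / Z + |Z' - Z| / Z := by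
          congr 1
          rw [div_sub_div _ _ hZpos.ne' hZ'pos.ne', one_mul, mul_one, abs_div,
            abs_of_pos (mul_pos hZpos hZ'pos)]
          field_simp
      _ ≤ η / Z + η / Z := add_le_add (div_le_div_of_nonneg_right hη hZpos.le)
          (div_le_div_of_nonneg_right hZZ' hZpos.le)
      _ = 2 * η / Z := by ring
      _ ≤ 2 * η / ζ := div_le_div_of_nonneg_left (by linarith) hζ hζZ
  -- conclude
  rw [hdiff]
  have i3 : Integrable (fun z => |φ z - m| * |q z|) u := by
    have : Integrable (fun z => (φ z - m) * q z) u :=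
      integrable_of_bounded ((hφm.sub measurable_const).mul hqm) (C := δ / 2 * (1 / Z + 1 / Z'))
        fun z => by rw [abs_mul]; exact mul_le_mul (hm z) (hqb z) (abs_nonneg _) (by linarith)
    simpa only [abs_mul] using this.abs
  calc |∫ z, (φ z - m) * q z ∂u| ≤ ∫ z, |(φ z - m) * q z| ∂u := abs_integral_le_integral_abs
    _ = ∫ z, |φ z - m| * |q z| ∂u := by simp_rw [abs_mul]
    _ ≤ ∫ z, (δ / 2) * |q z| ∂u := integral_mono i3 (iq.abs.const_mul _) fun z =>
        mul_le_mul_of_nonneg_right (hm z) (abs_nonneg _)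
    _ = (δ / 2) * ∫ z, |q z| ∂u := integral_const_mul _ _
    _ ≤ (δ / 2) * (2 * η / ζ) := mul_le_mul_of_nonneg_left hL1 (by linarith)
    _ = δ * η / ζ := by ring

end JastrowDobrushin

end Summit.AtomisticToContinuum.BoseEinsteinCondensation.Theorems
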